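import Literature.AlgebraicGeometry.HodgeTheory.GAGACechH1ComparisonCochains
import Literature.AlgebraicGeometry.HodgeTheory.GAGARegularOfHolomorphicNumerator
import Literature.AlgebraicGeometry.Resolution.SmoothStalksRegular
import HarnessLib

/-!
# GAGA on `H¹(𝒪)`, II: the comparison `Ȟ¹(𝔘, 𝒪_X) → Ȟ¹(𝔘^an, 𝒪^an)` is injective; the `finrank` bound

J.-P. Serre, *Géométrie algébrique et géométrie analytique*, Ann. Inst. Fourier 6 (1956), n° 12 Théorème 1
(`H^q(X, 𝓕) ⥲ H^q(X^h, 𝓕^h)`), here the injectivity for `𝓕 = 𝒪_X`, `q = 1`, on a fixed finite affine open cover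
`𝔘` of a smooth projective `X/ℂ` whose members have LOCALLY-ONE-EQUATION complements (`W ⊓ U_i = D(b)` near every
point — e.g. the standard cover of a projective embedding), with an analytic model `A` of `X`
(`ψ = A.toComplexPoints`):

* `mem_cechB1_of_cechHolδ_zero_eq` — THE GAGA STEP: if the realisation of an algebraic `1`-cocycle `z` as a
  holomorphic cochain (`GAGACechH1ComparisonCochains`) is a holomorphic coboundary `δ⁰γ₀`, then `z` is an
  algebraic coboundary: the holomorphic functions `h_i = -γ₀_i` on `ψ⁻¹U_i(ℂ)` have the regular differences
  `z_ij`, so they are regular by Serre's Prop. 15 in the form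
  `GAGARegularOfHolomorphicNumerator.exists_section_eval_eq_of_sub_eq_eval`, and sections of the reduced `X`
  are determined by their values at complex points;
* `exists_linearMap_cechH1_injective` — the comparison map `Ȟ¹(𝔘, 𝒪_X) → Ȟ¹(𝔘^an, 𝒪^an)` as an INJECTIVE
  `ℂ`-linear map (`Morphisms.CechH1 X.hom U →ₗ[ℂ] NatCochain.Cohomology (cechHolδ … 0) 1`);
* `finrank_cechH1_le_of_analyticModel` — `Ȟ¹(𝔘, 𝒪_X)` is finite-dimensional (coherent cohomology of the proper
  `X`, the tree's `cechH1_finite_holds`) and `finrank ℂ Ȟ¹(𝔘, 𝒪_X) ≤ finrank ℂ Ȟ¹(𝔘^an, 𝒪^an)`.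

Everything here is proved; no definitions, no named facts. Consumer: `AbelianVarietyCechH1StructureSheafBound`
(`dim Ȟ¹(𝔘, 𝒪_{A₀}) ≤ dim A₀` for complex abelian varieties; cell hodgecm-mathlib M13 node N3e).

## References

* [SerreGAGA1956] J.-P. Serre, Géométrie algébrique et géométrie analytique, Ann. Inst. Fourier 6 (1956),
  n° 12 Théorème 1 (p. 19), n° 19 Prop. 15 (pp. 29–30).
* [GortzWedhorn2023] U. Görtz, T. Wedhorn, Algebraic Geometry II (2023), Thm. 23.17 (finiteness of coherent
  cohomology of proper schemes).
* [SGA1] A. Grothendieck, SGA 1, Exp. XII Prop. 2.1 (i) (complex points are very dense).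
-/

noncomputable section

open scoped Manifold ContDiff Topology
open CategoryTheory AlgebraicGeometry Set TopologicalSpace
open Literature.AlgebraicGeometry.Motives (AlgPoints ComplexPoints SchemeOver IsSmoothProjective)
open Literature.AlgebraicGeometry.Motives.AlgPoints (evalOrZero)
open Literature.Geometry.Kaehler Literature.Algebra.Homology Literature.AlgebraicGeometry.Morphisms
open Literature.NumberTheory.Transcendental

namespace Literature.AlgebraicGeometry.HodgeTheory

universe u

section Values

variable {X : SchemeOver ℂ}

/-- Evaluation of regular functions at a complex point is additive (total form). [folklore] -/
private theorem evalOrZero_add' {O : X.left.Opens} (s t : Γ(X.left, O)) (P : ComplexPoints X) :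
    evalOrZero O (s + t) P = evalOrZero O s P + evalOrZero O t P := by
  by_cases hP : P.pt ∈ O
  · simp only [AlgPoints.evalOrZero_of_mem _ hP, AlgPoints.eval, map_add]
  · simp only [AlgPoints.evalOrZero_of_not_mem _ hP, add_zero]

/-- Evaluation of regular functions at a complex point respects subtraction (total form). [folklore] -/
private theorem evalOrZero_sub' {O : X.left.Opens} (s t : Γ(X.left, O)) (P : ComplexPoints X) :
    evalOrZero O (s - t) P = evalOrZero O s P - evalOrZero O t P := by
  by_cases hP : P.pt ∈ O
  · simp only [AlgPoints.evalOrZero_of_mem _ hP, AlgPoints.eval, map_sub]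
  · simp only [AlgPoints.evalOrZero_of_not_mem _ hP, sub_zero]

/-- Evaluation of regular functions at a complex point is multiplicative (total form). [folklore] -/
private theorem evalOrZero_mul' {O : X.left.Opens} (s t : Γ(X.left, O)) (P : ComplexPoints X) :
    evalOrZero O (s * t) P = evalOrZero O s P * evalOrZero O t P := by
  by_cases hP : P.pt ∈ O
  · simp only [AlgPoints.evalOrZero_of_mem _ hP, AlgPoints.eval, map_mul]
  · simp only [AlgPoints.evalOrZero_of_not_mem _ hP, mul_zero]

/-- The zero function evaluates to zero (total form). [folklore] -/
private theorem evalOrZero_zero' {O : X.left.Opens} (P : ComplexPoints X) : evalOrZero O (0 : Γ(X.left, O)) P = 0 := by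
  by_cases hP : P.pt ∈ O
  · simp only [AlgPoints.evalOrZero_of_mem _ hP, AlgPoints.eval, map_zero]
  · simp only [AlgPoints.evalOrZero_of_not_mem _ hP]

/-- The scalar `r ∈ ℂ ⊆ Γ(X, O)` (`Sections` algebra structure) takes the value `r` at every complex point of
`O`. [folklore] -/
private theorem evalOrZero_res_appTop_ΓSpecIso_inv {O : X.left.Opens} (r : ℂ) (P : ComplexPoints X)
    (hP : P.pt ∈ O) :
    evalOrZero O (X.left.presheaf.map (homOfLE (le_top : O ≤ ⊤)).op
      (X.hom.appTop ((Scheme.ΓSpecIso (.of ℂ)).inv r))) P = r := by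
  rw [AlgPoints.evalOrZero_of_mem _ hP, AlgPoints.eval_res P (le_top : O ≤ ⊤) hP, AlgPoints.eval_appTop_algebraMap]
  rfl

/-- A section of the reduced `ℂ`-scheme of finite type `X` vanishing at every complex point of its open is zero
(the non-vanishing locus `D(s)` is open and contains no closed point, hence is empty: closed points are very dense
in a Jacobson scheme). Same statement and proof as `FundamentalGroup.CharPolyRegular.eq_zero_of_forall_eval_eq_zero`
(not imported, to keep the Riemann-existence stack out of this file's import closure).
[cite: SGA1, Exp. XII Prop. 2.1 (i)] -/
private theorem eq_zero_of_forall_complexPoints_eval_eq_zero [LocallyOfFiniteType X.hom] [IsReduced X.left]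
    {O : X.left.Opens} (s : Γ(X.left, O))
    (hs : ∀ (P : ComplexPoints X) (hP : P.pt ∈ O), P.eval O hP s = 0) : s = 0 := by
  rw [← AlgebraicGeometry.basicOpen_eq_bot_iff]
  by_contra hne
  have hne' : ((X.left.basicOpen s : X.left.Opens) : Set X.left).Nonempty := by
    rw [Set.nonempty_iff_ne_empty]
    exact fun h ↦ hne (TopologicalSpace.Opens.coe_eq_empty.mp h)
  obtain ⟨P, hP⟩ := ComplexPoints.exists_pt_mem hne' (X.left.basicOpen s).isOpen.isLocallyClosed
  exact (AlgPoints.pt_mem_basicOpen_iff P (X.left.basicOpen_le s hP) s).mp hP (hs P _)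

end Values

section CechComparison

variable {n : ℕ} {X : SchemeOver ℂ}
  {E : Type} [NormedAddCommGroup E] [NormedSpace ℂ E] [FiniteDimensional ℂ E]
  (A : AnalyticModel E n X) {ι : Type} (U : ι → X.left.Opens)

/-- Points of `ψ⁻¹U_J(ℂ)` (`J` a pair) map into `U_{J 0} ∩ U_{J 1}`. [folklore] -/
private theorem pt_mem_inf_of_mem_cechSet_two (J : Fin 2 → ι) {x : A.carrier}
    (hx : x ∈ cechSet (A.coverSet U) J) : (A.toComplexPoints x).pt ∈ U (J 0) ⊓ U (J 1) := by
  have hx' := (mem_cechSet_fin_two_iff' (V := A.coverSet U)).1 hx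
  exact ⟨(A.mem_openSet_iff _ x).1 hx'.1, (A.mem_openSet_iff _ x).1 hx'.2⟩

/-- **A holomorphic coboundary of the realisation of an algebraic cocycle forces the cocycle to be an
algebraic coboundary** (the GAGA step: the holomorphic `0`-cochain consists of holomorphic functions `h_i` on
`ψ⁻¹U_i(ℂ)` with regular differences, hence regular by `exists_section_eval_eq_of_sub_eq_eval`; sections of the
reduced `X` agree when their values at all complex points do). [cite: SerreGAGA1956, n° 12 Théorème 1 (p. 19) and n° 19 Prop. 15 (pp. 29–30)] -/
theorem mem_cechB1_of_cechHolδ_zero_eq (hX : IsSmoothProjective n X) (hcov : ⨆ i, U i = ⊤)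
    (hU : ∀ (i : ι) (x : X.left), ∃ (W : X.left.Opens) (b : Γ(X.left, W)), x ∈ W ∧ W ⊓ U i = X.left.basicOpen b)
    (z : ↥(cechZ1 X.hom U))
    (γ : CechHolForms E A.carrier (A.coverSet U) (A.isOpen_coverSet U) 0 1)
    (hγ : ∀ (J : Fin 2 → ι) (x : A.carrier), x ∈ cechSet (A.coverSet U) J →
      ((γ J : ↥(pqFormsOn E A.carrier (cechSet (A.coverSet U) J) 0 0)) : MForm 𝓘(ℝ, E) A.carrier ℂ (0 + 0)) x 0 =
        evalOrZero (U (J 0) ⊓ U (J 1)) (Sections.equiv X.hom _ ((z : CechC1 X.hom U) (J 0) (J 1)))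
          (A.toComplexPoints x))
    (γ₀ : CechHolForms E A.carrier (A.coverSet U) (A.isOpen_coverSet U) 0 0)
    (h : cechHolδ E A.carrier (A.isOpen_coverSet U) 0 0 γ₀ = γ) :
    (z : CechC1 X.hom U) ∈ cechB1 X.hom U := by
  classical
  haveI : SmoothOfRelativeDimension n X.hom := hX.smoothOfRelativeDimension
  haveI : Smooth X.hom := SmoothOfRelativeDimension.smooth n X.hom
  haveI : LocallyOfFiniteType X.hom := inferInstance
  haveI : IsReduced X.left := Literature.AlgebraicGeometry.Resolution.isReduced_of_smooth X.hom
  have hcovX : ∀ x : X.left, ∃ j, x ∈ U j := fun x ↦ by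
    have hx : x ∈ (⨆ i, U i) := by rw [hcov]; trivial
    exact TopologicalSpace.Opens.mem_iSup.1 hx
  have hmemV : ∀ i (m : A.carrier), m ∈ A.coverSet U i ↔ (A.toComplexPoints m).pt ∈ U i := fun i m ↦
    A.mem_openSet_iff (U i) m
  -- the holomorphic functions `h_i = -γ₀_i` on `ψ⁻¹U_i(ℂ)`
  let hfun : ι → A.carrier → ℂ := fun i m ↦
    -(((γ₀ ![i] : ↥(pqFormsOn E A.carrier (cechSet (A.coverSet U) ![i]) 0 0)) :
      MForm 𝓘(ℝ, E) A.carrier ℂ (0 + 0)) m 0)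
  have hVset : ∀ i, cechSet (A.coverSet U) ![i] = A.coverSet U i := fun i ↦ by
    rw [cechSet_fin_one]; rfl
  have hVpre : ∀ i, A.toComplexPoints ⁻¹' {Q | Q.pt ∈ U i} = A.coverSet U i := fun i ↦
    Set.ext fun m ↦ (hmemV i m).symm
  have hhol : ∀ i, MDifferentiableOn 𝓘(ℂ, E) 𝓘(ℂ, ℂ) (hfun i) (A.toComplexPoints ⁻¹' {Q | Q.pt ∈ U i}) := by
    intro i
    rw [hVpre i, ← hVset i]
    exact (mdifferentiableOn_coe_apply_zero_of_holFormsOn (isOpen_cechSet (A.isOpen_coverSet U) ![i]) (γ₀ ![i])).neg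
  -- their differences are the regular `z_{ij}`
  have hpair0 : ∀ (i j : ι), ((![i, j] : Fin 2 → ι) ∘ Fin.succAbove 0) = ![j] := fun i j ↦ by
    funext s; fin_cases s; rfl
  have hpair1 : ∀ (i j : ι), ((![i, j] : Fin 2 → ι) ∘ Fin.succAbove 1) = ![i] := fun i j ↦ by
    funext s; fin_cases s; rfl
  have hfh : ∀ (i j : ι) (m : A.carrier), (A.toComplexPoints m).pt ∈ U i ⊓ U j →
      evalOrZero (U i ⊓ U j) (Sections.equiv X.hom _ ((z : CechC1 X.hom U) i j)) (A.toComplexPoints m) =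
        hfun i m - hfun j m := by
    intro i j m hm
    have hmV : m ∈ cechSet (A.coverSet U) ![i, j] :=
      (mem_cechSet_pair_iff' (V := A.coverSet U)).2 ⟨(hmemV i m).2 hm.1, (hmemV j m).2 hm.2⟩
    have e := congrArg (fun γ' : CechHolForms E A.carrier (A.coverSet U) (A.isOpen_coverSet U) 0 1 ↦
      ((γ' ![i, j] : ↥(pqFormsOn E A.carrier (cechSet (A.coverSet U) ![i, j]) 0 0)) :
        MForm 𝓘(ℝ, E) A.carrier ℂ (0 + 0)) m 0) h
    beta_reduce at e
    rw [coe_cechHolδ_zero_apply_of_mem (A.isOpen_coverSet U) γ₀ ![i, j] hmV, hγ ![i, j] m hmV] at e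
    have e0 := congrArg (fun K : Fin 1 → ι ↦
      ((γ₀ K : ↥(pqFormsOn E A.carrier (cechSet (A.coverSet U) K) 0 0)) : MForm 𝓘(ℝ, E) A.carrier ℂ (0 + 0)) m 0)
      (hpair0 i j)
    have e1 := congrArg (fun K : Fin 1 → ι ↦
      ((γ₀ K : ↥(pqFormsOn E A.carrier (cechSet (A.coverSet U) K) 0 0)) : MForm 𝓘(ℝ, E) A.carrier ℂ (0 + 0)) m 0)
      (hpair1 i j)
    beta_reduce at e0 e1
    rw [e0, e1] at e
    have e' : evalOrZero (U i ⊓ U j) (Sections.equiv X.hom _ ((z : CechC1 X.hom U) i j)) (A.toComplexPoints m) =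
        ((γ₀ ![j] : ↥(pqFormsOn E A.carrier (cechSet (A.coverSet U) ![j]) 0 0)) :
            MForm 𝓘(ℝ, E) A.carrier ℂ (0 + 0)) m 0 -
          ((γ₀ ![i] : ↥(pqFormsOn E A.carrier (cechSet (A.coverSet U) ![i]) 0 0)) :
            MForm 𝓘(ℝ, E) A.carrier ℂ (0 + 0)) m 0 := e.symm
    rw [e']
    ring
  -- GAGA: the `h_i` are regular
  have hreg := fun i ↦ exists_section_eval_eq_of_sub_eq_eval hX A.isAnalytification U hcovX hU hfun hhol
    (fun i j ↦ Sections.equiv X.hom _ ((z : CechC1 X.hom U) i j)) hfh i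
  choose c hc using hreg
  -- `z = δ⁰(-c)`
  refine (mem_cechB1_iff X.hom U _).2 ⟨fun i ↦ (Sections.equiv X.hom (U i)).symm (-c i), ?_⟩
  funext i j
  rw [cechD0_apply]
  have hsurj : ∀ P : ComplexPoints X, ∃ m, A.toComplexPoints m = P := fun P ↦
    ⟨A.isAnalytification.homeomorph.symm P, A.isAnalytification.homeomorph.apply_symm_apply P⟩
  have key : Sections.equiv X.hom _ ((z : CechC1 X.hom U) i j) -
      Sections.equiv X.hom _ (Sections.res X.hom inf_le_right ((Sections.equiv X.hom (U j)).symm (-c j)) -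
        Sections.res X.hom inf_le_left ((Sections.equiv X.hom (U i)).symm (-c i))) = 0 := by
    refine eq_zero_of_forall_complexPoints_eval_eq_zero _ fun P hP ↦ ?_
    obtain ⟨m, rfl⟩ := hsurj P
    rw [← AlgPoints.evalOrZero_of_mem _ hP, evalOrZero_sub', hfh i j m hP, map_sub, evalOrZero_sub']
    change hfun i m - hfun j m -
      (evalOrZero _ (X.left.presheaf.map (homOfLE inf_le_right).op (-c j)) (A.toComplexPoints m) -
        evalOrZero _ (X.left.presheaf.map (homOfLE inf_le_left).op (-c i)) (A.toComplexPoints m)) = 0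
    rw [AlgPoints.evalOrZero_map_homOfLE _ _ hP, AlgPoints.evalOrZero_map_homOfLE _ _ hP,
      show (-c j : Γ(X.left, U j)) = 0 - c j from (zero_sub _).symm, evalOrZero_sub', evalOrZero_zero',
      show (-c i : Γ(X.left, U i)) = 0 - c i from (zero_sub _).symm, evalOrZero_sub', evalOrZero_zero',
      hc j m hP.2, hc i m hP.1]
    ring
  exact ((Sections.equiv X.hom _).injective (sub_eq_zero.1 key)).symm

/-! ### The comparison map on `Ȟ¹` and the `finrank` bound -/

/-- **GAGA-injectivity on `H¹(𝒪)` (comparison-map form).** Let `X` be smooth projective over `ℂ` with an analytic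
model `A` (`X^an = A.carrier`, `ψ = A.toComplexPoints`), and `𝔘 = (U_i)` a finite open cover of `X` whose members have
LOCALLY-ONE-EQUATION complements (`W ⊓ U_i = D(b)` near every point). Then there is an INJECTIVE `ℂ`-linear map from
the algebraic Čech cohomology `Ȟ¹(𝔘, 𝒪_X)` (`Morphisms.CechH1 X.hom U`) to the Čech cohomology of holomorphic functions
of the analytic cover `𝔘^an = (ψ⁻¹U_i(ℂ))` (`NatCochain.Cohomology` of `cechHolδ … 0` in degree `1`): a class `(f_ij)`
goes to the holomorphic `0`-forms `z ↦ f_ij(ψ z)` on `ψ⁻¹U_ij(ℂ)`; a class killed on the analytic side is an algebraic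
coboundary by `mem_cechB1_of_cechHolδ_zero_eq` (Serre's Prop. 15, holomorphe ⇒ régulière).
[cite: SerreGAGA1956, n° 12 Théorème 1 (p. 19) and n° 19 Prop. 15 (pp. 29–30)] -/
theorem exists_linearMap_cechH1_injective (hX : IsSmoothProjective n X) (hcov : ⨆ i, U i = ⊤)
    (hU : ∀ (i : ι) (x : X.left), ∃ (W : X.left.Opens) (b : Γ(X.left, W)), x ∈ W ∧ W ⊓ U i = X.left.basicOpen b) :
    ∃ L : CechH1 X.hom U →ₗ[ℂ]
        NatCochain.Cohomology (R := ℂ)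
          (A := CechHolForms E A.carrier (A.coverSet U) (A.isOpen_coverSet U) 0)
          (cechHolδ E A.carrier (A.isOpen_coverSet U) 0) 1,
      Function.Injective L := by
  classical
  -- the realisations, by choice
  choose Φ hΦ using exists_cechHolForms_one_apply_eq A U
  choose Ψ hΨ using exists_cechHolForms_zero_apply_eq A U
  -- `Φ` is `ℂ`-linear
  have hΦadd : ∀ c c', Φ (c + c') = Φ c + Φ c' := fun c c' ↦
    cechHolForms_zero_ext (A.isOpen_coverSet U) fun J x hx ↦ by
      rw [hΦ (c + c') J x hx]
      change _ = ((Φ c J : ↥(pqFormsOn E A.carrier (cechSet (A.coverSet U) J) 0 0)) :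
          MForm 𝓘(ℝ, E) A.carrier ℂ (0 + 0)) x 0 +
        ((Φ c' J : ↥(pqFormsOn E A.carrier (cechSet (A.coverSet U) J) 0 0)) : MForm 𝓘(ℝ, E) A.carrier ℂ (0 + 0)) x 0
      rw [hΦ c J x hx, hΦ c' J x hx]
      change evalOrZero _ (Sections.equiv X.hom _ (c (J 0) (J 1) + c' (J 0) (J 1))) _ = _
      rw [map_add, evalOrZero_add']
  have hΦsmul : ∀ (r : ℂ) c, Φ (r • c) = r • Φ c := fun r c ↦
    cechHolForms_zero_ext (A.isOpen_coverSet U) fun J x hx ↦ by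
      rw [hΦ (r • c) J x hx]
      change _ = r * ((Φ c J : ↥(pqFormsOn E A.carrier (cechSet (A.coverSet U) J) 0 0)) :
        MForm 𝓘(ℝ, E) A.carrier ℂ (0 + 0)) x 0
      rw [hΦ c J x hx]
      change evalOrZero _ (X.left.presheaf.map (homOfLE (le_top : U (J 0) ⊓ U (J 1) ≤ ⊤)).op
          (X.hom.appTop ((Scheme.ΓSpecIso (.of ℂ)).inv r)) * Sections.equiv X.hom _ (c (J 0) (J 1))) _ = _
      rw [evalOrZero_mul', evalOrZero_res_appTop_ΓSpecIso_inv r _ (pt_mem_inf_of_mem_cechSet_two A U J hx)]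
  -- the holomorphic Čech complex and the map on cocycles
  let Lz : ↥(cechZ1 X.hom U) →ₗ[ℂ]
      ↥(NatCochain.cocycles (R := ℂ) (A := CechHolForms E A.carrier (A.coverSet U) (A.isOpen_coverSet U) 0) (cechHolδ E A.carrier (A.isOpen_coverSet U) 0) 1) :=
    { toFun := fun z ↦ ⟨Φ z, LinearMap.mem_ker.2 (cechHolδ_one_eq_zero_of_apply_eq A U z (Φ z) (hΦ z))⟩
      map_add' := fun z z' ↦ Subtype.ext (by
        change Φ ((z : CechC1 X.hom U) + z') = Φ z + Φ z'
        exact hΦadd _ _)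
      map_smul' := fun r z ↦ Subtype.ext (by
        change Φ (r • (z : CechC1 X.hom U)) = r • Φ z
        exact hΦsmul _ _) }
  let L0 := (NatCochain.Cohomology.mk _ 1).comp Lz
  have hL0 : ∀ z, L0 z = NatCochain.Cohomology.mk _ 1 (Lz z) := fun z ↦ rfl
  -- coboundaries go to zero
  have hK : (cechB1 X.hom U).comap (cechZ1 X.hom U).subtype ≤ LinearMap.ker L0 := by
    intro z hzK
    rw [Submodule.mem_comap, Submodule.subtype_apply, mem_cechB1_iff] at hzK
    obtain ⟨b, hb⟩ := hzK
    rw [LinearMap.mem_ker, hL0, NatCochain.Cohomology.mk_eq_zero_iff, NatCochain.mem_coboundaries_succ_iff]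
    refine ⟨Ψ b, cechHolδ_zero_eq_of_apply_eq A U b (Ψ b) (hΨ b) (Φ z) fun J x hx ↦ ?_⟩
    rw [hΦ z J x hx, ← hb]
  -- injectivity on `Ȟ¹`
  have hinj : LinearMap.ker L0 ≤ (cechB1 X.hom U).comap (cechZ1 X.hom U).subtype := by
    intro z hz0
    rw [LinearMap.mem_ker, hL0, NatCochain.Cohomology.mk_eq_zero_iff, NatCochain.mem_coboundaries_succ_iff] at hz0
    obtain ⟨γ₀, hγ₀⟩ := hz0
    rw [Submodule.mem_comap, Submodule.subtype_apply]
    exact mem_cechB1_of_cechHolδ_zero_eq A U hX hcov hU z (Φ z) (hΦ z) γ₀ hγ₀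
  refine ⟨((cechB1 X.hom U).comap (cechZ1 X.hom U).subtype).liftQ L0 hK, ?_⟩
  rw [← LinearMap.ker_eq_bot]
  exact Submodule.ker_liftQ_eq_bot _ _ _ hinj

/-- **`Ȟ¹(𝔘, 𝒪_X)` is finite-dimensional and `finrank ℂ Ȟ¹(𝔘, 𝒪_X) ≤ finrank ℂ Ȟ¹(𝔘^an, 𝒪^an)`** for a finite affine
cover `𝔘` of the smooth projective `X` whose members have locally-one-equation complements: finiteness is the tree's
`cechH1_finite_holds` (coherent cohomology of proper schemes, GW II Thm. 23.17 for `i = 1`), the inequality is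
`exists_linearMap_cechH1_injective`. [cite: SerreGAGA1956, n° 12 Théorème 1] -/
theorem finrank_cechH1_le_of_analyticModel (hX : IsSmoothProjective n X) [Finite ι] (hcov : ⨆ i, U i = ⊤)
    (haff : ∀ i, IsAffineOpen (U i))
    (hU : ∀ (i : ι) (x : X.left), ∃ (W : X.left.Opens) (b : Γ(X.left, W)), x ∈ W ∧ W ⊓ U i = X.left.basicOpen b)
    [Module.Finite ℂ (NatCochain.Cohomology (R := ℂ)
      (A := CechHolForms E A.carrier (A.coverSet U) (A.isOpen_coverSet U) 0)
      (cechHolδ E A.carrier (A.isOpen_coverSet U) 0) 1)] :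
    Module.Finite ℂ (CechH1 X.hom U) ∧
      Module.finrank ℂ (CechH1 X.hom U) ≤ Module.finrank ℂ (NatCochain.Cohomology (R := ℂ)
        (A := CechHolForms E A.carrier (A.coverSet U) (A.isOpen_coverSet U) 0)
        (cechHolδ E A.carrier (A.isOpen_coverSet U) 0) 1) := by
  haveI : IsProper X.hom := IsSmoothProjective.isProper_holds hX
  have hfin : Module.Finite ℂ (CechH1 X.hom U) := cechH1_finite_holds X.hom U haff hcov
  obtain ⟨L, hL⟩ := exists_linearMap_cechH1_injective A U hX hcov hU
  exact ⟨hfin, LinearMap.finrank_le_finrank_of_injective hL⟩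

end CechComparison

end Literature.AlgebraicGeometry.HodgeTheory
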